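import Summits.FinalStateConjecture.FinalStateConjecture.Theorems.EIHFluxBalanceInertialRecessionRechartZone
import Summits.FinalStateConjecture.FinalStateConjecture.Theorems.EIHFluxBalanceInertialRecessionRechartZone2

/-!
# Route EIHFluxBalance — `InertialRecession`, re-charting: the causal transfer WITHOUT the
# loitering clause (lab-time causality + exhaustion instead)

Helper file for the crux `stmt-FinalStateConjecture-10166`
(`Summit.FinalStateConjecture.FinalStateConjecture.Theses.EIHFluxBalance.InertialRecession`),
stub `stub_rechart` of line `sublinear-is-free-clean-window-charges`.

`exterior_subset_certified_union_causalPast₂`: the conclusion of `…RechartTransfer`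
(`O ⊆ certified-late(τ₁) ∪ J⁻(certified slab(τ₁))` for all `τ₁ ≥ τ₀'`) with its HOVER hypothesis
replaced by certified static flow above `r₊ + δ`, eventual lab-time causality of the chart,
future-closedness of `O` below the late image, the lab/model dictionaries and thresholds: a ball
point with lagging hole time in the uncertifiable layer `(r₊, r₊ + δ)` is carried to a tilted slab
by the zone lemma (`…RechartZone`) applied to an exhaustion curve from it to a late lab slab.

[O'Neill 1983, Ch. 14, pp. 402–404; folklore causal bookkeeping]
-/

noncomputable section

set_option linter.dupNamespace false

open Set Filter Topology Function TopologicalSpace Literature.Geometry.Lorentzian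
open scoped Manifold ContDiff

namespace Summit.FinalStateConjecture.FinalStateConjecture.Theorems

/-- Threshold bookkeeping (registered helper stub `affine_threshold_rechart` of the crux item):
`(τ₁ + βRz)/α ≤ T ≤ t` and `α > 0` give `τ₁ + βRz ≤ αt`. [folklore] -/
theorem affine_threshold_rechart : ∀ {α β Rz τ₁ t T : ℝ}, 0 < α → (τ₁ + β * Rz) / α ≤ T → T ≤ t → τ₁ + β * Rz ≤ α * t :=
  fun hα h1 h2 ↦ by
    have := (div_le_iff₀ hα).mp (h1.trans h2)
    linarith

section Transfer

variable {𝓢 : Spacetime 4} {N : ℕ} (U : Opens E4) (Φ : U → 𝓢.carrier) (O : Set 𝓢.carrier)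
  (Pext : U → Prop) (rp : Fin N → U → ℝ) (rH δ Rz : Fin N → ℝ)
  (Kb : Fin N → ModelBackground) (ψ : ∀ i, (Kb i).domain → 𝓢.carrier)
  (R : Fin N → ℝ → ℝ) (hRm : ∀ i, Monotone (R i))
  (U₀ : Opens E4) (hU₀ : U₀ ≤ U) (Rb T₂ : ℝ → ℝ) (α β : Fin N → ℝ) {τ₀ τ₀' τT Tc S : ℝ}
  (hτ : τ₀ < τ₀') (hτT : τT < τ₀') (hTc : Tc ≤ τ₀') (hβ : ∀ i, 0 ≤ β i) (hα : ∀ i, 0 < α i)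
  -- exhaustion (vii), lab-time causality, `O` below the late image
  (hexh : ∀ t₁ : ℝ, τ₀ < t₁ → O \ Φ '' {x : U | t₁ < x.1 0 ∧ Pext x} ⊆
    𝓢.metric.causalPast 𝓢.timeOrientation (Φ '' {x : U | x.1 0 = t₁ ∧ Pext x}))
  (hT : ∀ x x' : U, τT < x.1 0 → Pext x → τT < x'.1 0 → Pext x' →
    Φ x' ∈ 𝓢.metric.causalFuture 𝓢.timeOrientation {Φ x} → x.1 0 ≤ x'.1 0)
  (hOcl : ∀ p ∈ O, ∀ z : 𝓢.carrier, z ∈ 𝓢.metric.causalFuture 𝓢.timeOrientation {p} →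
    z ∈ 𝓢.metric.causalPast 𝓢.timeOrientation (Φ '' {x : U | τ₀ < x.1 0 ∧ Pext x}) → z ∈ O)
  (himO : Φ '' {x : U | τ₀ < x.1 0 ∧ Pext x} ⊆ O)
  -- the charts
  (hemb : IsOpenEmbedding (({x : U | τ₀ < x.1 0} : Set U).restrict Φ))
  (hrpc : ∀ i, Continuous (rp i))
  (hψemb : ∀ i, IsOpenEmbedding (ψ i)) (hKt : ∀ i, Continuous (Kb i).time)
  (hKr : ∀ i, Continuous (Kb i).radius)
  (hlab : ∀ (i : Fin N) (y : (Kb i).domain) (x : U), Φ x = ψ i y → Tc ≤ x.1 0 →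
    (Kb i).radius y.1 < Rz i → rp i x = (Kb i).radius y.1)
  (hsplit : ∀ x : U, τ₀' ≤ x.1 0 → Pext x → x.1 ∈ (U₀ : Set E4) ∨ ∃ i, rp i x ≤ Rb (x.1 0))
  (hPext : ∀ (x : U) (i : Fin N), Pext x → rH i < rp i x)
  (hcov : ∀ (i : Fin N) (x : U), Tc ≤ x.1 0 → rH i < rp i x → rp i x ≤ Rb (x.1 0) →
    ∃ y : (Kb i).domain, ψ i y = Φ x ∧ (Kb i).radius y.1 = rp i x ∧
      |(Kb i).time y.1 - α i * x.1 0| ≤ β i * rp i x)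
  (hRz : ∀ (i : Fin N) (t : ℝ), τ₀' ≤ t → Rz i ≤ Rb t) (hδRz : ∀ i, rH i + δ i ≤ Rz i)
  (hT₂ : ∀ (i : Fin N) (τ₁ : ℝ), (τ₁ + β i * Rz i) / α i ≤ T₂ τ₁ ∧ τ₁ ≤ T₂ τ₁)
  -- certified static flow, meshing
  (hstat : ∀ (i : Fin N) (y : (Kb i).domain) (τ₁ : ℝ), τ₀' ≤ τ₁ → S ≤ (Kb i).time y.1 →
    (Kb i).time y.1 ≤ τ₁ → rH i + δ i ≤ (Kb i).radius y.1 →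
    (Kb i).radius y.1 ≤ R i ((Kb i).time y.1) →
      ψ i y ∈ 𝓢.metric.causalPast 𝓢.timeOrientation (ψ i '' (Kb i).truncTimeSlab (R i τ₁) τ₁))
  (hmesh : ∀ (i : Fin N) (t : ℝ), τ₀' ≤ t → S ≤ α i * t - β i * Rb t ∧
    Rb t ≤ R i (α i * t - β i * Rb t) ∧ α i * t + β i * Rb t ≤ t)
  (hzone : ∀ (i : Fin N) (t : ℝ), τ₀' ≤ t → S ≤ α i * t - β i * Rz i ∧
    Rz i ≤ R i (α i * t - β i * Rz i) ∧ Rz i ≤ R i t)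

include hRm hτ hτT hTc hβ hα hexh hT hOcl himO hemb hrpc hψemb hKt hKr hlab hsplit hPext hcov hRz
  hδRz hT₂ hstat hmesh hzone in
/-- **The transfer without loitering.** For every chart time `τ₁ ≥ τ₀'`, every point of `O` is
certified-late after `τ₁` or lies in the causal past of the certified slab at `τ₁`. As in
`exterior_subset_certified_union_causalPast`, except that a ball point with lagging hole time in
the uncertifiable layer `r < r₊ + δ` is carried to a tilted slab by the ZONE LEMMA applied to an
exhaustion curve from it to the lab slab `t₂ = max (x⁰ + 1) (T₂ τ₁)` (all of whose points are late
chart points, `exists_late_preimage_of_curve`). [folklore] -/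
theorem exterior_subset_certified_union_causalPast₂ (τ₁ : ℝ) (hτ₁ : τ₀' ≤ τ₁) :
    O ⊆ ((Φ ∘ Opens.inclusion hU₀) '' {x : U₀ | τ₁ < x.1 0} ∪
        ⋃ i, ψ i '' {y | τ₁ < (Kb i).time y.1 ∧ (Kb i).radius y.1 ≤ R i ((Kb i).time y.1)}) ∪
      𝓢.metric.causalPast 𝓢.timeOrientation
        ((Φ ∘ Opens.inclusion hU₀) '' {x : U₀ | x.1 0 = τ₁} ∪
          ⋃ i, ψ i '' (Kb i).truncTimeSlab (R i τ₁) τ₁) := by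
  set certS : Set 𝓢.carrier := (Φ ∘ Opens.inclusion hU₀) '' {x : U₀ | x.1 0 = τ₁} ∪
    ⋃ i, ψ i '' (Kb i).truncTimeSlab (R i τ₁) τ₁ with hcertS
  have hholeS : ∀ i, ψ i '' (Kb i).truncTimeSlab (R i τ₁) τ₁ ⊆ certS := fun i ↦
    (subset_iUnion (fun i ↦ ψ i '' (Kb i).truncTimeSlab (R i τ₁) τ₁) i).trans subset_union_right
  have hJmono : ∀ i, 𝓢.metric.causalPast 𝓢.timeOrientation
      (ψ i '' (Kb i).truncTimeSlab (R i τ₁) τ₁) ⊆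
        𝓢.metric.causalPast 𝓢.timeOrientation certS := fun i ↦
    LorentzianMetric.causalFuture_mono (hholeS i)
  -- injectivity of the lab chart on the late region
  have hinj : ∀ x x' : U, τ₀ < x.1 0 → τ₀ < x'.1 0 → Φ x = Φ x' → x = x' := by
    intro x x' hx hx' h
    have := hemb.injective
      (show ({x : U | τ₀ < x.1 0} : Set U).restrict Φ ⟨x, hx⟩ =
        ({x : U | τ₀ < x.1 0} : Set U).restrict Φ ⟨x', hx'⟩ from h)
    exact congrArg Subtype.val this
  -- REACH: a late ball point with lab time `≥ τ₁` and hole time `≤ τ₁` reaches its tilted slab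
  have hreach : ∀ (i : Fin N) (x : U), τ₀' ≤ x.1 0 → Pext x → τ₁ ≤ x.1 0 →
      ∀ y : (Kb i).domain, ψ i y = Φ x → S ≤ (Kb i).time y.1 → (Kb i).time y.1 ≤ τ₁ →
        (Kb i).radius y.1 ≤ R i ((Kb i).time y.1) →
        Φ x ∈ 𝓢.metric.causalPast 𝓢.timeOrientation
          (ψ i '' (Kb i).truncTimeSlab (R i τ₁) τ₁) := by
    intro i x hxτ hxP hx₁ y hyψ hyS hyt hyR
    by_cases hcert : rH i + δ i ≤ (Kb i).radius y.1
    · rw [← hyψ]; exact hstat i y τ₁ hτ₁ hyS hyt hcert hyR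
    rw [not_le] at hcert
    have hyRz : (Kb i).radius y.1 < Rz i := hcert.trans_le (hδRz i)
    -- an exhaustion curve from `Φ x` to the lab slab `t₂`
    set t₂ : ℝ := max (x.1 0 + 1) (T₂ τ₁) with ht₂
    have ht₂x : x.1 0 < t₂ := (lt_add_one _).trans_le (le_max_left _ _)
    have ht₂T : T₂ τ₁ ≤ t₂ := le_max_right _ _
    have ht₂τ₁ : τ₁ ≤ t₂ := (hT₂ i τ₁).2.trans ht₂T
    have ht₂0 : τ₀ < t₂ := (hτ.trans_le (hτ₁.trans ht₂τ₁))
    have hx0 : τ₀ < x.1 0 := hτ.trans_le hxτ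
    have hxO : Φ x ∈ O := himO ⟨x, ⟨hx0, hxP⟩, rfl⟩
    have hnot : Φ x ∉ Φ '' {x' : U | t₂ < x'.1 0 ∧ Pext x'} := by
      rintro ⟨x', ⟨h1, -⟩, h⟩
      have := hinj x' x (ht₂0.trans h1) hx0 h
      rw [this] at h1
      linarith
    have hJ := hexh t₂ ht₂0 ⟨hxO, hnot⟩
    rcases exists_isFutureCausalCurveOn_of_mem_causalPast hJ with hmem | ⟨γ, a, b, hab, hγ, hγa, hγb⟩
    · obtain ⟨x', ⟨h1, -⟩, h⟩ := hmem
      have := hinj x' x (by rw [h1]; exact ht₂0) hx0 h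
      rw [this] at h1
      linarith
    have hγb' : γ b ∈ Φ '' {x' : U | τ₀ < x'.1 0 ∧ Pext x'} := by
      obtain ⟨x', ⟨h1, h2⟩, h⟩ := hγb
      exact ⟨x', ⟨by rw [h1]; exact ht₂0, h2⟩, h⟩
    have hlate : ∀ s ∈ Icc a b, ∃ x' : U, Φ x' = γ s ∧ τ₀ < x'.1 0 ∧ Pext x' ∧ τ₁ ≤ x'.1 0 := by
      intro s hs
      obtain ⟨x', hx', hx'0, hx'P, hx'x⟩ := exists_late_preimage_of_curve U Φ O Pext hτ hτT hexh
        hT hOcl x hxτ hxP hxO hγ hγa hγb' hs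
      exact ⟨x', hx', hx'0, hx'P, hx₁.trans hx'x⟩
    have hend : ∀ y' : (Kb i).domain, ψ i y' = γ b → (Kb i).radius y'.1 < Rz i →
        τ₁ ≤ (Kb i).time y'.1 := by
      intro y' hy'b hy'r
      obtain ⟨xb, ⟨hxb0, hxbP⟩, hxb⟩ := hγb
      have hxb0' : τ₀ < xb.1 0 := by rw [hxb0]; exact ht₂0
      have hxbτ : τ₀' ≤ xb.1 0 := by rw [hxb0]; exact hτ₁.trans ht₂τ₁
      have hrb : rp i xb < Rz i := by
        rw [hlab i y' xb (hxb.trans hy'b.symm) (hTc.trans hxbτ) hy'r]; exact hy'r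
      obtain ⟨y'', hy''ψ, -, hy''t⟩ := hcov i xb (hTc.trans hxbτ) (hPext xb i hxbP)
        (hrb.le.trans (hRz i _ hxbτ))
      have hyy : y'' = y' := (hψemb i).injective (by rw [hy''ψ, hxb, hy'b])
      rw [hyy, hxb0] at hy''t
      have h1 : α i * t₂ - β i * rp i xb ≤ (Kb i).time y'.1 := by
        have := (abs_le.mp hy''t).1; linarith
      have h2 : β i * rp i xb ≤ β i * Rz i := mul_le_mul_of_nonneg_left hrb.le (hβ i)
      have h3 : τ₁ + β i * Rz i ≤ α i * t₂ := affine_threshold_rechart (hα i) (hT₂ i τ₁).1 ht₂T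
      linarith
    rw [← hγa]
    exact mem_causalPast_slab_of_zone' U Φ Pext rp rH δ Rz Kb ψ R hRm Rb α β hTc hemb hrpc hψemb
      hKt hKr hlab hPext hcov hRz hδRz hstat hzone i τ₁ hτ₁ hab.le hγ hlate y (hyψ.trans hγa.symm)
      hyt hyRz hend
  -- Claim A: the lab slab `τ₁` of the painted exterior lies in `J⁻(certS)`
  have hA : Φ '' {x : U | x.1 0 = τ₁ ∧ Pext x} ⊆
      𝓢.metric.causalPast 𝓢.timeOrientation certS := by
    rintro _ ⟨x, ⟨hx0, hxP⟩, rfl⟩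
    have hxτ : τ₀' ≤ x.1 0 := by rw [hx0]; exact hτ₁
    rcases hsplit x hxτ hxP with hU | ⟨i, hi⟩
    · exact LorentzianMetric.subset_causalPast _ _ _ (Or.inl ⟨⟨x.1, hU⟩, hx0, rfl⟩)
    · obtain ⟨y, hyψ, hyS, hyt, hyR⟩ := exists_model_point_of_ball U Φ rp rH Kb ψ R hRm Rb α β
        hTc hβ hcov hmesh i x hxτ (hPext x i hxP) hi
      obtain ⟨-, -, h3⟩ := hmesh i (x.1 0) hxτ
      have hy₁ : (Kb i).time y.1 ≤ τ₁ := by rw [← hx0]; exact hyt.trans h3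
      exact hJmono i (hreach i x hxτ hxP hx0.ge y hyψ hyS hy₁ hyR)
  -- Claim B: the painted exterior after lab time `τ₁` is certified-late or in `J⁻(certS)`
  have hB : Φ '' {x : U | τ₁ < x.1 0 ∧ Pext x} ⊆
      ((Φ ∘ Opens.inclusion hU₀) '' {x : U₀ | τ₁ < x.1 0} ∪
        ⋃ i, ψ i '' {y | τ₁ < (Kb i).time y.1 ∧ (Kb i).radius y.1 ≤ R i ((Kb i).time y.1)}) ∪
      𝓢.metric.causalPast 𝓢.timeOrientation certS := by
    rintro _ ⟨x, ⟨hx0, hxP⟩, rfl⟩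
    have hxτ : τ₀' ≤ x.1 0 := hτ₁.trans hx0.le
    rcases hsplit x hxτ hxP with hU | ⟨i, hi⟩
    · exact Or.inl (Or.inl ⟨⟨x.1, hU⟩, hx0, rfl⟩)
    · obtain ⟨y, hyψ, hyS, -, hyR⟩ := exists_model_point_of_ball U Φ rp rH Kb ψ R hRm Rb α β
        hTc hβ hcov hmesh i x hxτ (hPext x i hxP) hi
      rcases lt_or_ge τ₁ ((Kb i).time y.1) with h | h
      · exact Or.inl (Or.inr (mem_iUnion.mpr ⟨i, y, ⟨h, hyR⟩, hyψ⟩))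
      · exact Or.inr (hJmono i (hreach i x hxτ hxP hx0.le y hyψ hyS h hyR))
  -- exhaustion at lab time `τ₁`, then `J⁻ ∘ J⁻ = J⁻`
  intro p hp
  by_cases hpE : p ∈ Φ '' {x : U | τ₁ < x.1 0 ∧ Pext x}
  · exact hB hpE
  · have hJ := hexh τ₁ (hτ.trans_le hτ₁) ⟨hp, hpE⟩
    exact Or.inr (mem_causalPast_of_subset_causalPast
      (WithTop.coe_le_coe.mpr le_top : (2 : ℕ∞ω) ≤ ∞) hJ hA)

end Transfer

end Summit.FinalStateConjecture.FinalStateConjecture.Theorems
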